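import Literature.NumberTheory.Automorphic.TorusCharacterSplitRigidityLocal
import Mathlib.NumberTheory.NumberField.CMField
import HarnessLib

/-!
# Rigidity of automorphic characters of `T = U(1)_{K/F₀}` from the split places — plain-`MonoidHom` and CM-field currencies

Topic `NumberTheory/Automorphic`; namespace `Literature.NumberTheory.Automorphic.UnitaryGroup`.  PROOF FILE (theorems only; no
definition, no named fact, no instance, no notation, no `sorry`), a re-spelling sequel of ★ `TorusCharacterSplitRigidityLocal`
(`torusCharacter_eq_one_of_torusLocalComponent_eq_one_of_split`: an automorphic continuous character of the adelic norm-one torus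
`T(𝔸_{F₀}) = TorusDict.torus c ≤ 𝕀_K` whose local component `ψ ∘ locTorusIncl v` is trivial at every finite place `v` of `F₀`
SPLIT in `K` is trivial — weak approximation for the anisotropic one-dimensional torus, ★ `TorusCharacterSplitRigidity`, over
Artin–Whaples ★ `HeckeCharacterWeakApproximation.denseRange_algebraMap_pi_prod` and idelic Hilbert 90 ★
`TorusDict.twistToTorus_surjective`).

Two currencies consumers meet:

* §1 `torusCharRigidSplit_of_continuous` — the character is a bare `θ : T(𝔸_{F₀}) →* ℂˣ` whose `ℂ`-valued coercion
  `t ↦ (θ t : ℂ)` is continuous (the form in which representation-theoretic central characters arrive), automorphy is the literal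
  clause `(t : 𝕀_K) ∈ principalIdeles K → θ t = 1`, and the split-place clause is pointwise on `locTorusIncl K c v t`.
* §2 `torusCharRigidSplit_cm` — the CM specialisation `F₀ := K⁺ = maximalRealSubfield L`, `c := IsCMField.complexConj L`
  (Mathlib `NumberField.IsCMField`: `[L : L⁺] = 2`, `complexConj L ≠ 1`), i.e. `T = U(1)_{L/L⁺}`: the text of the organ
  «T-RIGID» (`TorusCharRigidSplitLetter`) of the Hodge-CM programme's «ZENTRUM» sub-leaf, token for token.

## References
* J. W. S. Cassels, A. Fröhlich (eds.), *Algebraic Number Theory* (1967), Ch. II §6 (weak approximation), Ch. VII (Tate) §4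
  Prop. 4.1 and its proof [CasselsFrohlichANT1967].
* V. Platonov, A. Rapinchuk, *Algebraic Groups and Number Theory* (1994), §7.3 Prop. 7.8 (weak approximation for rational
  tori), §6.2 (the norm-one torus) [PlatonovRapinchuk1994].
* J. Rogawski, *Automorphic Representations of Unitary Groups in Three Variables* (1990), §13.1 p. 199 [Rogawski1990].
-/

set_option autoImplicit false

noncomputable section

open NumberField IsDedekindDomain
open Literature.NumberTheory.GaloisRepresentations
open Literature.NumberTheory.Automorphic.Arthur2013.Leaves.TECR

namespace Literature.NumberTheory.Automorphic

namespace UnitaryGroup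

/-! ## §1 Plain-`MonoidHom` currency over a general quadratic extension `K/F₀` -/

section General

variable {F₀ K : Type} [Field F₀] [NumberField F₀] [Field K] [NumberField K] [Algebra F₀ K]
  (c : K ≃ₐ[F₀] K) (h2 : Module.finrank F₀ K = 2) (hc : c ≠ 1)

omit [NumberField F₀] in
/-- A character `θ : T(𝔸_{F₀}) →* ℂˣ` whose `ℂ`-valued coercion is continuous is continuous into `ℂˣ` (the inverse coordinate
is `t ↦ (θ t : ℂ)⁻¹`, continuous off `0`). [cite: PlatonovRapinchuk1994, §6.2] -/
theorem continuous_torusHom_of_continuous_coe (θ : ↥(TorusDict.torus c) →* ℂˣ)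
    (hθ : Continuous fun t => ((θ t : ℂˣ) : ℂ)) : Continuous θ := by
  refine Units.continuous_iff.2 ⟨hθ, ?_⟩
  have h' : Continuous fun t => ((θ t : ℂˣ) : ℂ)⁻¹ := hθ.inv₀ fun t => (θ t).ne_zero
  refine h'.congr fun t => ?_
  simp [Units.val_inv_eq_inv_val]

include h2 hc in
/-- **RIGIDITY FROM THE SPLIT PLACES, plain-`MonoidHom` currency.**  Let `K/F₀` be a quadratic extension of number fields with
non-trivial automorphism `c`, and `θ : T(𝔸_{F₀}) →* ℂˣ` a character of the adelic norm-one torus `T(𝔸_{F₀}) = {x ∈ 𝕀_K : x·(c•x) = 1}`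
such that (i) `t ↦ (θ t : ℂ)` is continuous, (ii) `θ` is trivial on the principal ideles lying in the torus (`θ` is automorphic), and
(iii) `θ` is trivial on the local torus `T(F₀,v) ↪ T(𝔸_{F₀})` (★ `locTorusIncl`) at every finite place `v` of `F₀` that SPLITS in `K`
(some place of `K` above `v` is moved by `c`).  Then `θ = 1`.  This is ★
`torusCharacter_eq_one_of_torusLocalComponent_eq_one_of_split` (weak approximation for the anisotropic torus: `T(F₀)·∏'_{v split} T(F₀,v)`
is dense in `T(𝔸_{F₀})`; the non-split and archimedean local tori are compact and need no hypothesis) read on the underlying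
`MonoidHom`. [cite: CasselsFrohlichANT1967, Ch. VII §4 Prop. 4.1 (proof); Ch. II §6] [cite: PlatonovRapinchuk1994, §7.3 Prop. 7.8] -/
theorem torusCharRigidSplit_of_continuous (θ : ↥(TorusDict.torus c) →* ℂˣ)
    (hθ : Continuous fun t => ((θ t : ℂˣ) : ℂ))
    (hP : ∀ t : ↥(TorusDict.torus c), (t : ideleGroup K) ∈ principalIdeles K → θ t = 1)
    (hS : ∀ v : HeightOneSpectrum (𝓞 F₀), (∃ w : PlacesOver K v, c • w.1 ≠ w.1) →
      ∀ t : ↥(normOneUnits (conjLocal K c v)), θ (locTorusIncl K c v t) = 1) :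
    θ = 1 := by
  set ψ : ↥(TorusDict.torus c) →ₜ* ℂˣ :=
    { toMonoidHom := θ, continuous_toFun := continuous_torusHom_of_continuous_coe c θ hθ }
  have hψ : TorusDict.IsAutomorphic c ψ := fun t ht => hP t ht
  have key := torusCharacter_eq_one_of_torusLocalComponent_eq_one_of_split c h2 hc ψ hψ fun v hv =>
    MonoidHom.ext fun t => by
      rw [torusLocalComponent_apply, MonoidHom.one_apply]
      exact hS v hv t
  refine MonoidHom.ext fun t => ?_
  exact DFunLike.congr_fun key t

end General

/-! ## §2 The CM-field currency `T = U(1)_{L/L⁺}` -/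

section CM

/-- **RIGIDITY FROM THE SPLIT PLACES for `U(1)_{L/L⁺}` of a CM field `L`** (the organ «T-RIGID» of the «ZENTRUM» sub-leaf, text
VERBATIM): an automorphic character `θ` of the adelic norm-one torus `T(𝔸_{L⁺}) = TorusDict.torus (complexConj L)` — `t ↦ (θ t : ℂ)`
continuous, `θ` trivial on the principal ideles in the torus — whose restriction to the local torus is trivial at every finite place of
`L⁺` split in `L`, is trivial.  From §1 at `F₀ := L⁺`, `c := complexConj L` (Mathlib: `[L : L⁺] = 2`, `complexConj L ≠ 1`).
[cite: CasselsFrohlichANT1967, Ch. VII §4 Prop. 4.1 (proof); Ch. II §6] [cite: PlatonovRapinchuk1994, §7.3 Prop. 7.8, §6.2] -/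
theorem torusCharRigidSplit_cm (L : Type) [Field L] [NumberField L] [IsCMField L]
    (θ : ↥(TorusDict.torus (IsCMField.complexConj L)) →* ℂˣ)
    (hθ : Continuous (fun t => ((θ t : ℂˣ) : ℂ)))
    (hP : ∀ t : ↥(TorusDict.torus (IsCMField.complexConj L)), (t : ideleGroup L) ∈ principalIdeles L → θ t = 1)
    (hS : ∀ v : HeightOneSpectrum (𝓞 ↥(maximalRealSubfield L)),
        (∃ w : PlacesOver L v, IsCMField.complexConj L • w.1 ≠ w.1) →
        ∀ t : ↥(normOneUnits (conjLocal L (IsCMField.complexConj L) v)),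
          θ (locTorusIncl L (IsCMField.complexConj L) v t) = 1) :
    θ = 1 :=
  torusCharRigidSplit_of_continuous (IsCMField.complexConj L)
    (Algebra.IsQuadraticExtension.finrank_eq_two (↥(maximalRealSubfield L)) L) (IsCMField.complexConj_ne_one L) θ hθ hP hS

/-- The same, stated as the universally quantified sentence (the exact shape of the letter `TorusCharRigidSplitLetter` of the
«ZENTRUM» sub-leaf, so that the letter closes by this name). [cite: CasselsFrohlichANT1967, Ch. VII §4 Prop. 4.1 (proof)]
[cite: PlatonovRapinchuk1994, §7.3 Prop. 7.8] -/
theorem torusCharRigidSplit_cm_forall :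
    ∀ (L : Type) [Field L] [NumberField L] [IsCMField L]
      (θ : ↥(TorusDict.torus (IsCMField.complexConj L)) →* ℂˣ),
      Continuous (fun t => ((θ t : ℂˣ) : ℂ)) →
      (∀ t : ↥(TorusDict.torus (IsCMField.complexConj L)), (t : ideleGroup L) ∈ principalIdeles L → θ t = 1) →
      (∀ v : HeightOneSpectrum (𝓞 ↥(maximalRealSubfield L)),
          (∃ w : PlacesOver L v, IsCMField.complexConj L • w.1 ≠ w.1) →
          ∀ t : ↥(normOneUnits (conjLocal L (IsCMField.complexConj L) v)),
            θ (locTorusIncl L (IsCMField.complexConj L) v t) = 1) →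
      θ = 1 :=
  fun L _ _ _ θ hθ hP hS => torusCharRigidSplit_cm L θ hθ hP hS

end CM

end UnitaryGroup

end Literature.NumberTheory.Automorphic

end
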